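import Mathlib
import Literature.AlgebraicGeometry.Resolution.TameQuotientSingularitiesResolutionProofs
import HarnessLib

/-!
# Crux `TeissierResolve` (stmt-ResolutionOfSingularities-17086), line `Sketch` — stub
# `stub_finiteType_gradeZero`: the degree-`0` part of a finitely generated graded algebra

**Statement.** Let `k` be a field, `A` a finite abelian group and `S = ⨁_{a ∈ A} S_a` a commutative
`k`-algebra graded by `A` (Mathlib `GradedAlgebra 𝒮`, `𝒮 : A → Submodule k S`). If `S` is of
finite type over `k`, then so is its degree-`0` part `S₀ = 𝒮 0` (with the `k`-algebra structure
`SetLike.GradeZero.instAlgebra`). Geometrically: an `A`-grading is an action of the finite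
diagonalizable group scheme `D(A) = Spec k[A]` on `Spec S`, `S₀` is the ring of invariants, and the
quotient `Spec S₀ = (Spec S)/D(A)` is again of finite type over `k` (Hilbert–Noether finiteness of
invariants, diagonalizable case). In the line this is the hypothesis `hFT` of the chart-assembly
step: the Bergh–Rydh charts `Spec S₀ → X` must be of finite type over `k` before Artin
approximation applies.

**Proof.** E. Noether's argument in graded form: a homogeneous `s ∈ S_a` satisfies
`s ^ (addOrderOf a) ∈ S₀` (graded multiplication and `addOrderOf a • a = 0`; every element of a
finite group has finite order), so every homogeneous element — hence, decomposing into homogeneous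
components, every element — of `S` is integral over `S₀`; `S` is of finite type over `k`, a
fortiori over `S₀`, and integral, hence module-finite over `S₀`; Artin–Tate (`k ⊆ S₀ ⊆ S`, `k`
Noetherian, `S` of finite type over `k` and module-finite over `S₀`, Mathlib `fg_of_fg_of_fg`)
gives `S₀` of finite type over `k`. All of this is already in the tree, for an arbitrary
Noetherian base ring and torsion grading group:
`Literature.AlgebraicGeometry.Resolution.DiagonalizableQuotient.finiteType_gradeZero`
(`Literature/AlgebraicGeometry/Resolution/TameQuotientSingularitiesResolutionProofs.lean`), of
which the stub is the special case `R = k` a field, `A` finite; this file only specialises it.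

Sources: Atiyah–Macdonald, Prop. 7.8 (Artin–Tate) and Exercise 5.12 ff. (invariants of finite
groups); G. Kemper, *A Course in Commutative Algebra* (2011), §2 (Hilbert's finiteness theorem for
invariants); SGA 3, Exp. VIII §§4–5 (diagonalizable groups and gradings). No new definitions, no
named facts.
-/

noncomputable section

set_option linter.dupNamespace false -- mandated namespace of this single-conjunct summit

open Literature.AlgebraicGeometry.Resolution

namespace Summit.ResolutionOfSingularities.ResolutionOfSingularities.Theorems.TeissierResolve.FiniteTypeGradeZero

/-- **The degree-`0` part of a finitely generated `k`-algebra graded by a finite abelian group is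
finitely generated.** For a field `k`, a finite additive commutative group `A` and a commutative
`k`-algebra `S` of finite type graded by `A` (`GradedAlgebra 𝒮`), the `k`-algebra `𝒮 0` is of
finite type (homogeneous elements are integral over `𝒮 0` since `s ^ (addOrderOf a) ∈ 𝒮 0`, so
`S` is module-finite over `𝒮 0`; then Artin–Tate). Special case of
`DiagonalizableQuotient.finiteType_gradeZero` (Noetherian base, torsion grading). [folklore] -/
theorem stub_finiteType_gradeZero (k : Type) [Field k] (A : Type) [AddCommGroup A] [Finite A]
    [DecidableEq A] (S : Type) [CommRing S] [Algebra k S] (𝒮 : A → Submodule k S)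
    [GradedAlgebra 𝒮] [Algebra.FiniteType k S] : Algebra.FiniteType k (𝒮 0) :=
  DiagonalizableQuotient.finiteType_gradeZero 𝒮 fun a => isOfFinAddOrder_of_finite a

end Summit.ResolutionOfSingularities.ResolutionOfSingularities.Theorems.TeissierResolve.FiniteTypeGradeZero

end
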